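import Literature.NumberTheory.Automorphic.UnitaryGroupBorelInduction
import HarnessLib

/-!
# The Bruhat decomposition `U(Φ₃)(L⁺_v) = B ⊔ B w₀ N` of the quasi-split unitary group in three variables at a NON-SPLIT place
# (relative rank one, `W = {1, w₀}`) — ONE NAMED FACT (Casselman 1995 Prop. 1.3.1; Borel–Tits 1965 §5)

Topic `NumberTheory/Automorphic`; namespace `Literature.NumberTheory.Automorphic.UnitaryGroup` (continues ★ `UnitaryGroupBorelInduction`:
`borelU`, `torusU`, `unipotentU`, `cmLocalForm`, `conjLocal`).  ONE NAMED FACT `def U3LocalBruhatDecomposition (L) : Prop` (net debt +1: a printed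
theorem typed as a HYPOTHESIS of record, D-0014); no `sorry`, no instance, no notation, no other declaration.  Cell `hodgecm-mathlib`, F0∕P3
topic T3 (Keys NF1 `KeysCaseTwo`): node F1 of the statement tree `F0/P3/T3b-TREE.md` §1 — the frame fact from which the in-house proofs of N1
(`U3PrincipalSeriesJacquetFiltration`, ★ p826240: the two `(B, B)`-double cosets give the two steps of the Bruhat filtration of `i_G(χ)|_B`,
Casselman §6.3) and of the intertwining-operator node K5a start; it does NOT enter the Lines composition `T3b_KeysCaseTwoPaydown`.
HC_CM is proved only modulo the printed citations until rung 0 closes; this fact, if consumed, ENTERS that list.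

## The print
[Casselman1995] Prop. 1.3.1 p. 11: «If `Θ, Ω` are subsets of `Δ`, then one has a disjoint union decomposition `G = ∐ P_Θ w P_Ω` where `w` ranges
over the set `[W_Θ\W/W_Ω]`. … Proof. One knows that `(G, P_∅, N(A_∅), S)` form a Tits system»; Prop. 1.3.3 (structure of `P_Θ w P_Ω`:
`P_Θ w P_Ω = P_Θ w N_{w⁻¹}`-type normal form with the unipotent coordinate unique); §7.1 p. 67: «Let `P` be a maximal proper parabolic … The
split torus `A/A_Δ` is one-dimensional … `W(Θ, Θ) = {1, w}`».  [BorelTits1965] §5 (décomposition de Bruhat de `G(k)` relative aux `k`-sous-groupes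
paraboliques minimaux; the Tits system of the `k`-points).  For `G = U(Φ₃)(F)`, `E/F` a quadratic extension of `p`-adic FIELDS (a NON-SPLIT place):
the relative root system is `BC₁`, `Δ = {α}`, the only proper standard parabolic is the upper-triangular Borel `B = TN` ([Rogawski1990] §1.10 p. 9),
`W = {1, w₀}` with `w₀` represented by the antidiagonal matrix `Φ₃` itself (`ᵗΦ̄₃ Φ₃ Φ₃ = Φ₃`, so `Φ₃ ∈ U(Φ₃)`; it normalises `T`:
`Φ₃ d(α,β,γ) Φ₃⁻¹ = d(γ,β,α)`), and Prop. 1.3.1 reads `G = B ⊔ B w₀ B` with `B w₀ B = B w₀ N`, the pair `(b, n)` in `g = b w₀ n` being unique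
(`B ∩ w₀ N w₀⁻¹ = B ∩ N⁻ = 1`).  At a SPLIT place `U(Φ₃)(L⁺_v) ≅ GL₃(L⁺_v)` has Weyl group `S₃` and six cells — the statement below is false there,
whence the non-split hypothesis.

## References
* [Casselman1995] W. Casselman, *Introduction to the theory of admissible representations of p-adic reductive groups*, draft 1 May 1995,
  Prop. 1.3.1, Prop. 1.3.3 p. 11–12; §7.1 p. 67.
* [BorelTits1965] A. Borel, J. Tits, *Groupes réductifs*, Publ. Math. IHÉS 27 (1965), §5.
* [Rogawski1990] J. D. Rogawski, *Automorphic Representations of Unitary Groups in Three Variables* (1990), §1.9–§1.10 pp. 8–9.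
-/

noncomputable section

open NumberField IsDedekindDomain
open scoped MatrixGroups

namespace Literature.NumberTheory.Automorphic.UnitaryGroup

variable (L : Type) [Field L] [NumberField L] [IsCMField L]

/-- **NAMED FACT (F1) — BRUHAT DECOMPOSITION OF `U(Φ₃)(L⁺_v)` AT A NON-SPLIT PLACE** [Casselman1995 Prop. 1.3.1 for `Θ = Ω = ∅` in relative rank
one; Borel–Tits §5]: at every NON-SPLIT finite place `v` of `L⁺` (every `w ∣ v` fixed by complex conjugation), writing
`G = U(Φ₃)(L⁺_v) = ↥(unitaryGroupOfForm (c ⊗ 1) (cmLocalForm L 3 v))` (★ `cmDatum_Local_eq`), `B ≤ G` the upper-triangular Borel subgroup (★ `borelU`)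
and `N ≤ B` its unipotent radical (★ `unipotentU`), there is an element `w₀ ∈ G` whose matrix is the antidiagonal form matrix `Φ₃ = cmLocalForm L 3 v`
itself, NOT in `B`, such that (i) every `g ∈ G` lies in `B` or is `g = b · w₀ · n` with `b ∈ B`, `n ∈ N` («`G = B ⊔ B w₀ B`», `B w₀ B = B w₀ N`), and
(ii) the pair `(b, n)` is unique («`B ∩ w₀ N w₀⁻¹ = {1}`»).  False at a split place (six Bruhat cells), hence the hypothesis.  Used as a HYPOTHESIS of
in-house proofs of the geometric lemma for `i_G(χ)` (node N1) — nothing in the tree proves it yet. [cite: Casselman1995, Prop. 1.3.1, Prop. 1.3.3]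
[cite: BorelTits1965, §5] [cite: Rogawski1990, §1.10 p. 9] -/
def U3LocalBruhatDecomposition : Prop :=
  ∀ (v : HeightOneSpectrum (𝓞 ↥(maximalRealSubfield L))),
    (∀ w : PlacesOver L v, IsCMField.complexConj L • w.1 = w.1) →
    ∃ w₀ : ↥(unitaryGroupOfForm (conjLocal L (IsCMField.complexConj L) v) (cmLocalForm L 3 v)),
      Units.val (w₀ : GL (Fin 3) (LocalRing L v)) = cmLocalForm L 3 v ∧
      w₀ ∉ borelU (conjLocal L (IsCMField.complexConj L) v) (cmLocalForm L 3 v) ∧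
      (∀ g : ↥(unitaryGroupOfForm (conjLocal L (IsCMField.complexConj L) v) (cmLocalForm L 3 v)),
        g ∈ borelU (conjLocal L (IsCMField.complexConj L) v) (cmLocalForm L 3 v) ∨
          ∃ b ∈ borelU (conjLocal L (IsCMField.complexConj L) v) (cmLocalForm L 3 v),
            ∃ n ∈ unipotentU (conjLocal L (IsCMField.complexConj L) v) (cmLocalForm L 3 v), g = b * w₀ * n) ∧
      (∀ b ∈ borelU (conjLocal L (IsCMField.complexConj L) v) (cmLocalForm L 3 v),
        ∀ b' ∈ borelU (conjLocal L (IsCMField.complexConj L) v) (cmLocalForm L 3 v),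
        ∀ n ∈ unipotentU (conjLocal L (IsCMField.complexConj L) v) (cmLocalForm L 3 v),
        ∀ n' ∈ unipotentU (conjLocal L (IsCMField.complexConj L) v) (cmLocalForm L 3 v),
          b * w₀ * n = b' * w₀ * n' → b = b' ∧ n = n')

end Literature.NumberTheory.Automorphic.UnitaryGroup

end
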